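import Literature.AlgebraicGeometry.Motives.LinearCohomologyEllAdicTower
import Literature.AlgebraicGeometry.Motives.LinearCohomologyChangeOfRingsPullback
import Literature.AlgebraicGeometry.Motives.EtaleModCohomologyFunctoriality
import Literature.AlgebraicGeometry.Motives.EllAdicEtalePullback
import HarnessLib

/-!
# The `ℓ`-adic tower `X ↦ lim_m H•(X_ét, ℤ/ℓᵐ)` is a functor to graded `ℤ_ℓ`-algebras

Assembling `LinearCohomologyEllAdicTower.lean` (the tower `(Hⁿ(X_ét, ℤ/ℓᵐ), ρ_m)` of `ℤ/ℓᵐ`-linear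
étale cohomology rings and its limit with cup product and `ℤ_ℓ`-module structure),
`LinearCohomologyChangeOfRingsPullback.lean` (`ρ` commutes with pull-backs) and
`EtaleModCohomologyFunctoriality.lean` (`(g f)^* = f^* g^*`, `𝟙^* = id` levelwise):

* (maps of towers `towerLim.map`/`towerLim.mapLinear` are the tree's, `EllAdicEtalePullback.lean`);
* `etaleZModPowCohomologyMap f ℓ m n = f^* : Hⁿ(Y_ét, ℤ/ℓᵐ) → Hⁿ(X_ét, ℤ/ℓᵐ)` commutes with the
  reductions (`zmodPowReduction_etaleZModPowCohomologyMap`), hence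
* `etaleEllAdicTowerCohomologyMap f ℓ n : lim_m Hⁿ(Y_ét, ℤ/ℓᵐ) →ₗ[ℤ_ℓ] lim_m Hⁿ(X_ét, ℤ/ℓᵐ)`, which is
  multiplicative (`_cup`), unital (`_one`), and functorial (`_comp`, `_id`).

This is the functor "`H•(–, ℤ_ℓ) = lim H•(–, ℤ/ℓᵐ)`" of Milne V §1 (p. 176) / Deligne, Weil I (1.1),
with all the listed structure proved (no named facts).

## References

* J. S. Milne, *Étale cohomology* (reissue 2025; held copy): V §1 pp. 175–176, III Rem. 1.6 (c).
  [Milne2025]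
* P. Deligne, *La conjecture de Weil. I*, Publ. Math. IHÉS 43 (1974), (1.1). [Deligne1974]
-/

universe u

open CategoryTheory CategoryTheory.Limits AlgebraicGeometry Opposite CategoryTheory.Abelian

namespace Literature.AlgebraicGeometry.Motives

/-! ### The pull-back on the `ℓ`-adic tower of a morphism of schemes -/

section Etale

variable {X Y Z : Scheme.{u}} (f : X ⟶ Y) (g : Y ⟶ Z) (ℓ : ℕ) [Fact ℓ.Prime]

/-- **`f^* : Hⁿ(Y_ét, ℤ/ℓᵐ) → Hⁿ(X_ét, ℤ/ℓᵐ)`**, the level-`m` pull-back (`etaleModCohomologyMap` with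
coefficients `ℤ/ℓᵐ`; `ℤ/ℓᵐ`-linear, multiplicative, unital). [cite: Milne2025, III Remark 1.6 (c)] -/
noncomputable abbrev etaleZModPowCohomologyMap (m n : ℕ) :
    etaleZModPowCohomology Y ℓ m n →ₗ[ZModPow.{u} ℓ m] etaleZModPowCohomology X ℓ m n :=
  etaleModCohomologyMap f (ZModPow.{u} ℓ m) n

/-- **The level pull-backs commute with the reductions `ρ_m`** (an instance of
`reductionMap_etaleModCohomologyMap`). [cite: Milne2025, III Remark 1.6 (c)] -/
theorem zmodPowReduction_etaleZModPowCohomologyMap (m n : ℕ)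
    (x : etaleZModPowCohomology Y ℓ (m + 1) n) :
    zmodPowReduction (isTerminalEtaleMkId X) ℓ m n (etaleZModPowCohomologyMap f ℓ (m + 1) n x) =
      etaleZModPowCohomologyMap f ℓ m n (zmodPowReduction (isTerminalEtaleMkId Y) ℓ m n x) :=
  reductionMap_etaleModCohomologyMap f (zmodPowRed.{u} ℓ m) (zmodPowRed_surjective ℓ m)
    (ker_zmodPowRed ℓ m) (ZModPow.pow_mul_self ℓ m) (ZModPow.exists_of_mul_pow_eq_zero ℓ m)
    (ZModPow.exists_of_mul_eq_zero ℓ m) n x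

/-- **The pull-back `f^* : lim_m Hⁿ(Y_ét, ℤ/ℓᵐ) → lim_m Hⁿ(X_ét, ℤ/ℓᵐ)`**, `ℤ_ℓ`-linear, induced
levelwise (the tree's `towerLim.mapLinear`). [cite: Milne2025, V §1 (p. 176)] -/
noncomputable def etaleEllAdicTowerCohomologyMap (n : ℕ) :
    etaleEllAdicTowerCohomology Y ℓ n →ₗ[ℤ_[ℓ]] etaleEllAdicTowerCohomology X ℓ n :=
  towerLim.mapLinear ℓ (fun m => (etaleZModPowCohomologyMap f ℓ m n).toAddMonoidHom)
    fun m x => (zmodPowReduction_etaleZModPowCohomologyMap f ℓ m n x).symm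

/-- Components of the pull-back on the limit: `(f^* x)_m = f^*(x_m)`. [folklore] -/
@[simp]
theorem coe_etaleEllAdicTowerCohomologyMap_apply (n : ℕ) (x : etaleEllAdicTowerCohomology Y ℓ n)
    (m : ℕ) :
    (etaleEllAdicTowerCohomologyMap f ℓ n x : ∀ m, etaleZModPowCohomology X ℓ m n) m =
      etaleZModPowCohomologyMap f ℓ m n ((x : ∀ m, etaleZModPowCohomology Y ℓ m n) m) :=
  rfl

/-- **`f^*` is multiplicative on the `ℓ`-adic tower**: `f^*(x ∪ y) = f^* x ∪ f^* y`.
[cite: Milne2025, V Proposition 1.16 / III Remark 1.6 (c)] -/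
theorem etaleEllAdicTowerCohomologyMap_cup {i j n : ℕ} (h : i + j = n)
    (x : etaleEllAdicTowerCohomology Y ℓ i) (y : etaleEllAdicTowerCohomology Y ℓ j) :
    etaleEllAdicTowerCohomologyMap f ℓ n (ellAdicTowerCohomology.cup h x y) =
      ellAdicTowerCohomology.cup h (etaleEllAdicTowerCohomologyMap f ℓ i x)
        (etaleEllAdicTowerCohomologyMap f ℓ j y) :=
  Subtype.ext <| funext fun m => by
    rw [coe_etaleEllAdicTowerCohomologyMap_apply, ellAdicTowerCohomology.coe_cup,
      ellAdicTowerCohomology.coe_cup, coe_etaleEllAdicTowerCohomologyMap_apply,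
      coe_etaleEllAdicTowerCohomologyMap_apply]
    exact etaleModCohomologyMap_cup f (ZModPow.{u} ℓ m) h _ _

/-- **`f^*(1) = 1`** on the `ℓ`-adic tower. [folklore] -/
theorem etaleEllAdicTowerCohomologyMap_one :
    etaleEllAdicTowerCohomologyMap f ℓ 0 (ellAdicTowerCohomology.one (isTerminalEtaleMkId Y) ℓ) =
      ellAdicTowerCohomology.one (isTerminalEtaleMkId X) ℓ :=
  Subtype.ext <| funext fun m => by
    rw [coe_etaleEllAdicTowerCohomologyMap_apply, ellAdicTowerCohomology.coe_one,
      ellAdicTowerCohomology.coe_one]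
    exact etaleModCohomologyMap_one f (ZModPow.{u} ℓ m)

/-- **`(g ∘ f)^* = f^* ∘ g^*`** on the `ℓ`-adic tower. [cite: Milne2025, III Remark 1.6 (c)] -/
theorem etaleEllAdicTowerCohomologyMap_comp (n : ℕ) (x : etaleEllAdicTowerCohomology Z ℓ n) :
    etaleEllAdicTowerCohomologyMap (f ≫ g) ℓ n x =
      etaleEllAdicTowerCohomologyMap f ℓ n (etaleEllAdicTowerCohomologyMap g ℓ n x) :=
  Subtype.ext <| funext fun m => by
    rw [coe_etaleEllAdicTowerCohomologyMap_apply, coe_etaleEllAdicTowerCohomologyMap_apply,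
      coe_etaleEllAdicTowerCohomologyMap_apply]
    exact etaleModCohomologyMap_comp f g (ZModPow.{u} ℓ m) n _

/-- **`(𝟙_X)^* = id`** on the `ℓ`-adic tower. [cite: Milne2025, III Remark 1.6 (c)] -/
theorem etaleEllAdicTowerCohomologyMap_id (n : ℕ) (x : etaleEllAdicTowerCohomology X ℓ n) :
    etaleEllAdicTowerCohomologyMap (𝟙 X) ℓ n x = x :=
  Subtype.ext <| funext fun m => by
    rw [coe_etaleEllAdicTowerCohomologyMap_apply]
    exact etaleModCohomologyMap_id (ZModPow.{u} ℓ m) n _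

end Etale

end Literature.AlgebraicGeometry.Motives
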